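import Mathlib
import HarnessLib
import Summits.NavierStokesRegularity.FluidComputer.TriggeredTransferCascadeGluing
import Summits.NavierStokesRegularity.FluidComputer.TriggeredTransferZoom
import Summits.NavierStokesRegularity.FluidComputer.PalasekTowerClayBridgeUniquenessHolds

/-!
# Door N1-FC: viscosity is not a parameter of the door — the dilation `u ↦ κ·u(κt, x)` on schemes

Cell `ns-blowup`, seat `ns-blowup-fc-prover-2` (D-0074 GROUP C «bridge support»; LADDER-NS rung N1-FC
«η > 1/λ UNIFORMLY IN Re»). LABEL: E–C typing / calibration. WHAT THIS IS NOT: not Navier–Stokes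
evidence — a change of variables (Tao 2013, footnote 3: `u ↦ κ·u(κt,x)`, `p, f ↦ κ²·(p, f)(κt,x)`,
viscosity `ν ↦ κν`) applied to the OPEN predicates `TriggerScheme.Step` / `TriggerScheme.Transfers` of
`TriggeredTransfer.lean`; implications and equivalences between open predicates; no scheme instance, no
transfer, no blow-up is asserted; the DNS words of PREREG-FC-TRIG-1 and -2 (pub-fluidc) are MODEL readings and
never enter here.

The (C)-ENDPOINT is already viscosity-free in the tree (`BreakdownWitness.rescale`,
`palasekStep2_iff_unitViscosity`, `nonempty_breakdownWitness` at every `ν > 0`); this file records the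
same for the door's HYPOTHESIS. `TriggerScheme.dilate κ` (`κ > 0`) is the scheme read at amplitude
`× κ` (alphabet `V ↦ κ • F (V/κ)`, threshold `κ U⋆`, trigger constants `A i ↦ κ²·max(κ,1)^i·A i`, SAME
`λ, η, a, C_τ, q, R, c, D`); `IsTrigger.dilate`, `Step.dilate`, `Transfers.dilate : 𝒮.Transfers ν →
(𝒮.dilate κ).Transfers (κν)`; **`exists_transfers_iff_of_pos : 0 < ν → 0 < ν' → ((∃ 𝒮, 𝒮.Transfers ν)
↔ ∃ 𝒮, 𝒮.Transfers ν')`** — the route's words `∃ 𝒮, 𝒮.Transfers 1` ARE the hypothesis at the DNS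
viscosity `ν₀`, not an analogy in `ν`. The Re-DICTIONARY for a viscosity sweep on a fixed host
(`Step.of_div`): a step at viscosity `ν/κ` from `w` at amplitude `U` is a step of the dilated scheme at
viscosity `ν` from `κ • w` at amplitude `κU` — LOWERING THE VISCOSITY AT FIXED HOST = RAISING THE
AMPLITUDE AT FIXED VISCOSITY: a sweep `ν₀ → ν₀/κ` probes the `∀ U`-quantifier of `Transfers ν₀` on the
finite window `[U₀, κU₀]` of an infinite range (a LIVE word instantiates one `Step`; a NO-GO word refutes
`Transfers` for THAT alphabet only, `not_transfers_of_not_step`). For an AMPLITUDE-HOMOGENEOUS alphabet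
(`F (κU) = κ • F U`: shapes independent of the Reynolds number) the hypothesis is MONOTONE DOWNWARD IN
VISCOSITY for one and the same scheme, `Transfers.of_le : 𝒮.Transfers ν → 0 < ν' ≤ ν → 𝒮.Transfers ν'`,
so the NO-GO word at the LOWEST viscosity of a sweep is the strongest the sweep can print against the
design (`not_transfers_of_not_step_of_le`). Finally the door closes on Clay (C) at ANY viscosity with NO
named-fact hypothesis (`navierStokesBreakdownR3_of_exists_transfers_at`, via lean g5's
`tao_unconditional_uniqueness_velocity_forced_holds`). Tools, all in the tree: `timeRescale`,
`isClassicalNSSolutionOn_viscosityChange`, `norm_iteratedFDeriv_smul_stPull_le` (fc-prover-1),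
`lintegral_enorm_sq_const_smul`, `hasRapidSpatialDecay_const_smul`, `VectorCalculus.IsDivFree.const_smul`.

References: T. Tao, Anal. PDE 6 (2013) 25–107, footnote 3 (viscosity normalisation)
[cite: Tao2011, footnote 3]; T. Tao, J. Amer. Math. Soc. 29 (2016) §1.3 (one-shot transfer, the clock)
[cite: Tao2016AveragedNS, §1.3]; C. L. Fefferman, Clay problem description, (C) [cite: FeffermanClay2006, (C)].
0 sorry; axioms ⊆ {propext, Classical.choice, Quot.sound}.
-/

noncomputable section

namespace Summit.NavierStokesRegularity.FluidComputer.TriggeredTransfer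

open Set MeasureTheory Function
open scoped ENNReal ContDiff NNReal
open Literature.Analysis.FluidPDE
open Literature.Analysis.FluidPDE.FluidComputer (E3 Vel)
open Summit.NavierStokesRegularity.NavierStokesRegularity.Theorems (isClassicalNSSolutionOn_viscosityChange)
open Summit.NavierStokesRegularity.FluidComputer.PalasekTowerClayBridge (hasRapidSpatialDecay_const_smul
  tao_unconditional_uniqueness_velocity_forced_holds)

namespace TriggerScheme

variable (𝒮 : TriggerScheme)

/-! ## The dilated scheme -/

/-- **The scheme read at amplitude `× κ`** (`κ > 0`; the image of the time dilation
`u ↦ κ·u(κt, x)`, which multiplies the viscosity by `κ`): alphabet `V ↦ κ • F (V/κ)`, threshold `κ U⋆`,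
trigger shape constants `A i ↦ κ² · max(κ,1)^i · A i` (chain rule through `(t,x) ↦ (κt, x)`); the scale
ratio `λ`, the efficiency floor `η`, the e-fold budget `a`, the transfer-time law `(C_τ, q)`, the nest
radius `R`, the floor constant `c` and the displacement bound `D` are UNCHANGED. [cite: Tao2011, footnote 3] -/
def dilate (κ : ℝ) (hκ : 0 < κ) : TriggerScheme where
  lam := 𝒮.lam
  eta := 𝒮.eta
  UStar := κ * 𝒮.UStar
  F := fun V => (fun w : Vel => κ • w) '' 𝒮.F (V / κ)
  R := 𝒮.R
  c := 𝒮.c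
  D := 𝒮.D
  A := fun i => κ ^ 2 * (max κ 1) ^ i * 𝒮.A i
  a := 𝒮.a
  Cτ := 𝒮.Cτ
  q := 𝒮.q
  one_lt_lam := 𝒮.one_lt_lam
  kelvin := 𝒮.kelvin
  eta_le_one := 𝒮.eta_le_one
  UStar_pos := mul_pos hκ 𝒮.UStar_pos
  R_pos := 𝒮.R_pos
  c_pos := 𝒮.c_pos
  D_nonneg := 𝒮.D_nonneg
  A_nonneg := fun i =>
    mul_nonneg (mul_nonneg (sq_nonneg κ) (pow_nonneg (hκ.le.trans (le_max_left κ 1)) i)) (𝒮.A_nonneg i)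
  a_pos := 𝒮.a_pos
  Cτ_pos := 𝒮.Cτ_pos
  clay := by
    rintro V hV v ⟨w, hw, rfl⟩
    have hVκ : 𝒮.UStar ≤ V / κ := by rwa [le_div_iff₀ hκ, mul_comm]
    obtain ⟨h1, h2, h3⟩ := 𝒮.clay (V / κ) hVκ w hw
    exact ⟨h1.const_smul κ, VectorCalculus.IsDivFree.const_smul (h1.differentiable (by simp)) h2 κ,
      hasRapidSpatialDecay_const_smul h3 h1 κ⟩
  floor := by
    rintro V hV v ⟨w, hw, rfl⟩
    have hVκ : 𝒮.UStar ≤ V / κ := by rwa [le_div_iff₀ hκ, mul_comm]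
    obtain ⟨x, hxR, hfl⟩ := 𝒮.floor (V / κ) hVκ w hw
    refine ⟨x, hxR, ?_⟩
    show 𝒮.c * V ≤ ‖κ • w x‖
    rw [norm_smul, Real.norm_of_nonneg hκ.le]
    calc 𝒮.c * V = κ * (𝒮.c * (V / κ)) := by field_simp
      _ ≤ κ * ‖w x‖ := mul_le_mul_of_nonneg_left hfl hκ.le
  seed := by
    obtain ⟨U₀, hU₀, w₀, hw₀⟩ := 𝒮.seed
    refine ⟨κ * U₀, mul_le_mul_of_nonneg_left hU₀ hκ.le, κ • w₀, w₀, ?_, rfl⟩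
    rwa [mul_div_cancel_left₀ U₀ hκ.ne']

section Fields

variable (κ : ℝ) (hκ : 0 < κ)

/-- The dilation keeps the scale ratio. [folklore] -/
@[simp] theorem dilate_lam : (𝒮.dilate κ hκ).lam = 𝒮.lam := rfl
/-- The dilation keeps the efficiency floor. [folklore] -/
@[simp] theorem dilate_eta : (𝒮.dilate κ hκ).eta = 𝒮.eta := rfl
/-- The dilation multiplies the threshold amplitude by `κ`. [folklore] -/
@[simp] theorem dilate_UStar : (𝒮.dilate κ hκ).UStar = κ * 𝒮.UStar := rfl
/-- The dilated alphabet at amplitude `V` is `κ •` the alphabet at amplitude `V/κ`. [folklore] -/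
@[simp] theorem dilate_F (V : ℝ) : (𝒮.dilate κ hκ).F V = (fun w : Vel => κ • w) '' 𝒮.F (V / κ) := rfl
/-- The dilation keeps the nest radius. [folklore] -/
@[simp] theorem dilate_R : (𝒮.dilate κ hκ).R = 𝒮.R := rfl
/-- The dilation keeps the floor constant. [folklore] -/
@[simp] theorem dilate_c : (𝒮.dilate κ hκ).c = 𝒮.c := rfl
/-- The dilation keeps the displacement bound. [folklore] -/
@[simp] theorem dilate_D : (𝒮.dilate κ hκ).D = 𝒮.D := rfl
/-- The dilated trigger constants: `A i ↦ κ² · max(κ,1)^i · A i`. [folklore] -/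
@[simp] theorem dilate_A (i : ℕ) : (𝒮.dilate κ hκ).A i = κ ^ 2 * (max κ 1) ^ i * 𝒮.A i := rfl
/-- The dilation keeps the e-fold budget. [folklore] -/
@[simp] theorem dilate_a : (𝒮.dilate κ hκ).a = 𝒮.a := rfl
/-- The dilation keeps the transfer-time constant. [folklore] -/
@[simp] theorem dilate_Cτ : (𝒮.dilate κ hκ).Cτ = 𝒮.Cτ := rfl
/-- The dilation keeps the transfer-time exponent. [folklore] -/
@[simp] theorem dilate_q : (𝒮.dilate κ hκ).q = 𝒮.q := rfl
/-- The dilation keeps the amplitude growth factor `(ηλ)^{1/2}`. [folklore] -/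
@[simp] theorem dilate_growth : (𝒮.dilate κ hκ).growth = 𝒮.growth := rfl

/-- Members of the alphabet, multiplied by `κ`, are members of the dilated alphabet one dilation up:
`w ∈ F U ⇒ κ • w ∈ (dilate κ).F (κ U)`. [folklore] -/
theorem smul_mem_dilate_F {U : ℝ} {w : Vel} (hw : w ∈ 𝒮.F U) :
    κ • w ∈ (𝒮.dilate κ hκ).F (κ * U) := by
  rw [dilate_F, mul_div_cancel_left₀ U hκ.ne']
  exact mem_image_of_mem _ hw

end Fields

variable {𝒮}

/-! ## Transport of triggers, steps and the transfer predicate -/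

/-- The time dilation with amplitude is the amplitude times the space–time pull-back along
`(s, y) ↦ (κ s, y)`. [folklore] -/
theorem timeRescale_eq_smul_stPull_one {F : Type*} [NormedAddCommGroup F] [NormedSpace ℝ F]
    (κ C : ℝ) (ψ : ℝ → E3 → F) : timeRescale κ C ψ = C • stPull κ 1 0 (0 : E3) ψ := by
  funext s y
  simp only [timeRescale_apply, Pi.smul_apply, stPull_apply, zero_add, one_smul]

/-- **Triggers dilate**: if `g` is an admissible trigger of amplitude `ε` (margin `δ`, window `T`)
for `𝒮`, then `κ²·g(κt, x)` is one of amplitude `ε` (margin `δ/κ`, window `T/κ`) for `𝒮.dilate κ`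
(chain rule through `(t, x) ↦ (κt, x)`, operator norm `≤ max κ 1`). [folklore] -/
theorem IsTrigger.dilate {κ : ℝ} (hκ : 0 < κ) {ε δ T : ℝ} {g : ℝ → Vel}
    (hg : 𝒮.IsTrigger ε δ T g) :
    (𝒮.dilate κ hκ).IsTrigger ε (δ / κ) (T / κ) (timeRescale κ (κ ^ 2) g) where
  smooth := by
    rw [timeRescale_eq_smul_stPull_one]
    exact contDiff_uncurry_smul_stPull hg.smooth _ _ _ _ _
  off_early t ht := by
    funext x
    have hκt : κ * t ≤ δ := by rwa [le_div_iff₀ hκ, mul_comm] at ht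
    rw [timeRescale_apply, hg.off_early _ hκt, Pi.zero_apply, smul_zero]
  off_late t ht := by
    funext x
    have hκt : T ≤ κ * t := by rwa [div_le_iff₀ hκ, mul_comm] at ht
    rw [timeRescale_apply, hg.off_late _ hκt, Pi.zero_apply, smul_zero]
  off_far t x hx := by
    rw [timeRescale_apply, hg.off_far (κ * t) x (by simpa using hx), smul_zero]
  small i z := by
    rw [timeRescale_eq_smul_stPull_one, dilate_A]
    have hgi : ContDiff ℝ i (uncurry g) := hg.smooth.of_le (by exact_mod_cast le_top)
    refine (norm_iteratedFDeriv_smul_stPull_le hgi (κ ^ 2) hκ.le zero_le_one 0 (0 : E3) z).trans ?_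
    rw [abs_of_nonneg (sq_nonneg κ)]
    have hfac : 0 ≤ κ ^ 2 * (max κ 1) ^ i :=
      mul_nonneg (sq_nonneg κ) (pow_nonneg (hκ.le.trans (le_max_left κ 1)) i)
    calc κ ^ 2 * (max κ 1) ^ i * ‖iteratedFDeriv ℝ i (uncurry g) (0 + κ * z.1, (0 : E3) + (1 : ℝ) • z.2)‖
        ≤ κ ^ 2 * (max κ 1) ^ i * (ε * 𝒮.A i) := mul_le_mul_of_nonneg_left (hg.small i _) hfac
      _ = ε * (κ ^ 2 * (max κ 1) ^ i * 𝒮.A i) := by ring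

/-- **Steps dilate** (Tao's footnote 3 with the force slot, applied to one triggered transfer): a step
at viscosity `ν` from `w` at amplitude `U` with seed `ε` gives a step of `𝒮.dilate κ` at viscosity
`κν` from `κ • w` at amplitude `κU` with the SAME seed — hand-over time `T/κ` (the law
`C_τ (1 + |log ε|)^q / U` is exactly covariant), margin `δ/κ`, trigger `κ²·g(κt,x)`, solution
`κ·u(κt,x)`, energy `× κ²`, hand-over slice `κ • (λ-zoom of w') = λ-zoom of (κ • w')`.
[cite: Tao2011, footnote 3] -/
theorem Step.dilate {κ : ℝ} (hκ : 0 < κ) {ν U ε : ℝ} {w : Vel} (h : 𝒮.Step ν U ε w) :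
    (𝒮.dilate κ hκ).Step (κ * ν) (κ * U) ε (κ • w) := by
  obtain ⟨T, δ, g, u, p, hδ, h2δ, hT, hg, hsol, hu0, ⟨C, hC, hE⟩, U', w', x₀, hgrow, hw', hx₀, hhand⟩ :=
    h
  have hTδ : 0 < T + δ := by linarith
  have hsum : T / κ + δ / κ = (T + δ) / κ := (add_div T δ κ).symm
  -- the dilated time slab is mapped into the original one by `s ↦ κ s`
  have hmaps : MapsTo (fun s => κ * s) (Icc (0 : ℝ) ((T + δ) / κ)) (Icc 0 (T + δ)) := fun s hs =>
    ⟨mul_nonneg hκ.le hs.1, by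
      have := mul_le_mul_of_nonneg_left hs.2 hκ.le
      rwa [mul_div_cancel₀ _ hκ.ne'] at this⟩
  refine ⟨T / κ, δ / κ, timeRescale κ (κ ^ 2) g, timeRescale κ κ u, timeRescale κ (κ ^ 2) p,
    div_pos hδ hκ, ?_, ?_, hg.dilate hκ, ?_, ?_, ?_, κ * U', κ • w', x₀, ?_,
    𝒮.smul_mem_dilate_F κ hκ hw', hx₀, ?_⟩
  · -- `2 (δ/κ) < T/κ`
    rw [← mul_div_assoc]
    exact div_lt_div_of_pos_right h2δ hκ
  · -- the transfer-time law is covariant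
    rw [dilate_Cτ, dilate_q]
    calc T / κ ≤ 𝒮.Cτ * (1 + |Real.log ε|) ^ 𝒮.q / U / κ := div_le_div_of_nonneg_right hT hκ.le
      _ = 𝒮.Cτ * (1 + |Real.log ε|) ^ 𝒮.q / (κ * U) := by rw [div_div, mul_comm U κ]
  · -- the dilated solution (viscosity `κ ν`)
    rw [hsum]
    have h := isClassicalNSSolutionOn_viscosityChange hsol κ hmaps
      (uniqueDiffOn_Icc (div_pos hTδ hκ))
    exact h
  · -- initial slice
    rw [timeRescale_zero, hu0]
    rfl
  · -- finite energy on the slab (`× κ²`)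
    refine ⟨ENNReal.ofReal (κ ^ 2) * C, ENNReal.mul_lt_top ENNReal.ofReal_lt_top hC, fun t ht => ?_⟩
    rw [hsum] at ht
    rw [timeRescale_slice, lintegral_enorm_sq_const_smul]
    exact mul_le_mul_right (hE (κ * t) (hmaps ht)) _
  · -- amplitude bookkeeping: `growth · (κU) ≤ κU'`
    rw [dilate_growth, mul_left_comm]
    exact mul_le_mul_of_nonneg_left hgrow hκ.le
  · -- the hand-over slice is the `λ`-zoom of `κ • w'`
    funext x
    rw [timeRescale_apply, mul_div_cancel₀ _ hκ.ne', hhand, dilate_lam, Pi.smul_apply, smul_comm]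

/-- **The Re-dictionary for a viscosity sweep on a fixed host**: a step at the LOWER viscosity `ν/κ`
from `w` at amplitude `U` is a step of the dilated scheme at viscosity `ν` from `κ • w` at the HIGHER
amplitude `κU` (`κ > 0`). Lowering the viscosity on a fixed host reads the door's `∀ U`-quantifier
further out, and nothing else. [cite: Tao2011, footnote 3] -/
theorem Step.of_div {κ : ℝ} (hκ : 0 < κ) {ν U ε : ℝ} {w : Vel} (h : 𝒮.Step (ν / κ) U ε w) :
    (𝒮.dilate κ hκ).Step ν (κ * U) ε (κ • w) := by
  have := h.dilate hκ
  rwa [mul_div_cancel₀ _ hκ.ne'] at this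

/-- **The transfer predicate dilates**: if `𝒮` transfers at viscosity `ν`, then `𝒮.dilate κ`
transfers at viscosity `κν` (the admissibility clause `ν |log ε| ≤ a U` is exactly covariant).
[cite: Tao2011, footnote 3] -/
theorem Transfers.dilate {κ : ℝ} (hκ : 0 < κ) {ν : ℝ} (h : 𝒮.Transfers ν) :
    (𝒮.dilate κ hκ).Transfers (κ * ν) := by
  rintro V hV v ⟨w, hw, rfl⟩ ε hε hε1 hadm
  rw [dilate_UStar] at hV
  rw [dilate_a] at hadm
  have hVκ : 𝒮.UStar ≤ V / κ := by rwa [le_div_iff₀ hκ, mul_comm]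
  have hadm' : ν * |Real.log ε| ≤ 𝒮.a * (V / κ) := by
    rw [← mul_div_assoc, le_div_iff₀ hκ]
    calc ν * |Real.log ε| * κ = κ * ν * |Real.log ε| := by ring
      _ ≤ 𝒮.a * V := hadm
  have hstep := (h (V / κ) hVκ w hw ε hε hε1 hadm').dilate hκ
  rwa [mul_div_cancel₀ _ hκ.ne'] at hstep

/-! ## The door hypothesis is viscosity-free -/

/-- **One viscosity gives all, for the door's hypothesis**: a transferring scheme at viscosity
`ν > 0` yields one at any other viscosity `ν' > 0` (dilate by `κ = ν'/ν`). [cite: Tao2011, footnote 3] -/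
theorem exists_transfers_of_exists_transfers {ν ν' : ℝ} (hν : 0 < ν) (hν' : 0 < ν')
    (h : ∃ 𝒮 : TriggerScheme, 𝒮.Transfers ν) : ∃ 𝒮 : TriggerScheme, 𝒮.Transfers ν' := by
  obtain ⟨𝒮, hT⟩ := h
  refine ⟨𝒮.dilate (ν' / ν) (div_pos hν' hν), ?_⟩
  have := hT.dilate (div_pos hν' hν)
  rwa [div_mul_cancel₀ ν' hν.ne'] at this

/-- **Viscosity is not a parameter of door N1-FC.** For all `ν, ν' > 0`:
`(∃ 𝒮, 𝒮.Transfers ν) ↔ (∃ 𝒮, 𝒮.Transfers ν')`. [cite: Tao2011, footnote 3] -/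
theorem exists_transfers_iff_of_pos {ν ν' : ℝ} (hν : 0 < ν) (hν' : 0 < ν') :
    (∃ 𝒮 : TriggerScheme, 𝒮.Transfers ν) ↔ ∃ 𝒮 : TriggerScheme, 𝒮.Transfers ν' :=
  ⟨exists_transfers_of_exists_transfers hν hν', exists_transfers_of_exists_transfers hν' hν⟩

/-- **The route's words are the hypothesis at the DNS viscosity.** For every `ν₀ > 0` (e.g. the
PREREG's `ν₀`): `(∃ 𝒮, 𝒮.Transfers ν₀) ↔ (∃ 𝒮, 𝒮.Transfers 1)` — the physics item of a TRIGGERED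
route, filed at unit viscosity, is literally the statement a model cell reads at its own viscosity.
[cite: Tao2011, footnote 3] -/
theorem exists_transfers_iff_unitViscosity {ν : ℝ} (hν : 0 < ν) :
    (∃ 𝒮 : TriggerScheme, 𝒮.Transfers ν) ↔ ∃ 𝒮 : TriggerScheme, 𝒮.Transfers 1 :=
  exists_transfers_iff_of_pos hν one_pos

/-- **Clay (C) from the door at ANY viscosity, no named-fact hypothesis.** A transferring one-shot
triggered-transfer scheme at some viscosity `ν > 0` gives `NavierStokesBreakdownR3`: cascade gluing
(`nonempty_breakdownWitness`, fc-prover-1) + one witness at one viscosity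
(`navierStokesBreakdownR3_of_witness`) + Tao's forced Cor. 11.4, now a tree THEOREM
(`tao_unconditional_uniqueness_velocity_forced_holds`). [cite: FeffermanClay2006, (C)] -/
theorem navierStokesBreakdownR3_of_exists_transfers_at {ν : ℝ} (hν : 0 < ν)
    (h : ∃ 𝒮 : TriggerScheme, 𝒮.Transfers ν) :
    Summit.NavierStokesRegularity.NavierStokesRegularity.NavierStokesBreakdownR3 := by
  obtain ⟨𝒮, hT⟩ := h
  exact 𝒮.navierStokesBreakdownR3_of_transfers hν hT tao_unconditional_uniqueness_velocity_forced_holds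

/-! ## What a word at one viscosity says about one scheme -/

/-- **A NO-GO word refutes the transfer predicate of THAT alphabet**: one admissible
`(U, w, ε)` — `U ≥ U⋆`, `w ∈ F U`, `0 < ε ≤ 1`, `ν |log ε| ≤ a U` — without a step refutes
`𝒮.Transfers ν` (and nothing existential: other alphabets are untouched). [folklore] -/
theorem not_transfers_of_not_step {ν U ε : ℝ} {w : Vel} (hU : 𝒮.UStar ≤ U) (hw : w ∈ 𝒮.F U)
    (hε : 0 < ε) (hε1 : ε ≤ 1) (hadm : ν * |Real.log ε| ≤ 𝒮.a * U) (hno : ¬ 𝒮.Step ν U ε w) :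
    ¬ 𝒮.Transfers ν :=
  fun h => hno (h U hU w hw ε hε hε1 hadm)

/-- **A LIVE word instantiates one step and no more**: `Transfers` at viscosity `ν` needs the step
from every member at EVERY amplitude `U ≥ U⋆`; in particular along any run the amplitudes are
unbounded (`TriggeredTransferLedger.exists_run_tendsto`), so no finite amplitude window — and, by
`Step.of_div`, no finite viscosity window on a fixed host — exhausts the quantifier. The trivial
direction, recorded for the census: the universal statement gives each instance. [folklore] -/
theorem Transfers.step {ν : ℝ} (h : 𝒮.Transfers ν) {U ε : ℝ} {w : Vel} (hU : 𝒮.UStar ≤ U)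
    (hw : w ∈ 𝒮.F U) (hε : 0 < ε) (hε1 : ε ≤ 1) (hadm : ν * |Real.log ε| ≤ 𝒮.a * U) :
    𝒮.Step ν U ε w :=
  h U hU w hw ε hε hε1 hadm

/-! ## Amplitude-homogeneous alphabets: the door is monotone downward in viscosity -/

/-- **Amplitude-homogeneous alphabet** (a predicate on schemes): the designed level states at
amplitude `κU` are exactly the `κ`-multiples of those at amplitude `U` (`κ > 0`) — the shapes do not
depend on the Reynolds number (e.g. `F U = U • F₁` for one shape class `F₁`). A property a scheme
may or may not have; the door does not assume it. [folklore] -/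
def AmplitudeHomogeneous (𝒯 : TriggerScheme) : Prop :=
  ∀ κ : ℝ, 0 < κ → ∀ U : ℝ, 𝒯.F (κ * U) = (fun w : Vel => κ • w) '' 𝒯.F U

/-- For a homogeneous alphabet the dilated alphabet is the original one. [folklore] -/
theorem AmplitudeHomogeneous.dilate_F_eq (hH : 𝒮.AmplitudeHomogeneous) {κ : ℝ} (hκ : 0 < κ) (V : ℝ) :
    (𝒮.dilate κ hκ).F V = 𝒮.F V := by
  rw [dilate_F, ← hH κ hκ (V / κ), mul_div_cancel₀ _ hκ.ne']

/-- A trigger of the dilated scheme with `κ ≤ 1` is a trigger of the original scheme (its shape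
constants `κ² · max(κ,1)^i · A i = κ² A i` are not larger; `ε ≥ 0`). [folklore] -/
theorem IsTrigger.of_dilate_of_le_one {κ : ℝ} (hκ : 0 < κ) (hκ1 : κ ≤ 1) {ε δ T : ℝ} (hε : 0 ≤ ε)
    {g : ℝ → Vel} (hg : (𝒮.dilate κ hκ).IsTrigger ε δ T g) : 𝒮.IsTrigger ε δ T g where
  smooth := hg.smooth
  off_early := hg.off_early
  off_late := hg.off_late
  off_far t x hx := hg.off_far t x (by simpa using hx)
  small i z := by
    refine (hg.small i z).trans ?_
    rw [dilate_A, max_eq_right hκ1, one_pow, mul_one]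
    have hκ2 : κ ^ 2 ≤ 1 := pow_le_one₀ hκ.le hκ1
    calc ε * (κ ^ 2 * 𝒮.A i) = κ ^ 2 * (ε * 𝒮.A i) := by ring
      _ ≤ 1 * (ε * 𝒮.A i) :=
          mul_le_mul_of_nonneg_right hκ2 (mul_nonneg hε (𝒮.A_nonneg i))
      _ = ε * 𝒮.A i := one_mul _

/-- A step of the dilated scheme with `κ ≤ 1` is a step of the original scheme at the same arguments,
for a homogeneous alphabet (same transfer-time law, weaker triggers, same hand-over family).
[folklore] -/
theorem Step.of_dilate_of_le_one (hH : 𝒮.AmplitudeHomogeneous) {κ : ℝ} (hκ : 0 < κ) (hκ1 : κ ≤ 1)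
    {ν U ε : ℝ} (hε : 0 ≤ ε) {w : Vel} (h : (𝒮.dilate κ hκ).Step ν U ε w) : 𝒮.Step ν U ε w := by
  obtain ⟨T, δ, g, u, p, hδ, h2δ, hT, hg, hsol, hu0, hE, U', w', x₀, hgrow, hw', hx₀, hhand⟩ := h
  rw [hH.dilate_F_eq hκ] at hw'
  exact ⟨T, δ, g, u, p, hδ, h2δ, hT, hg.of_dilate_of_le_one hκ hκ1 hε, hsol, hu0, hE, U', w', x₀, hgrow,
    hw', hx₀, hhand⟩

/-- **Downward monotonicity in viscosity (homogeneous alphabets).** If the alphabet is amplitude-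
homogeneous and the scheme transfers at viscosity `ν`, then THE SAME scheme transfers at every
viscosity `0 < ν' ≤ ν`: a member `w ∈ F U` at viscosity `ν'` is `κ • w₁`, `κ = ν'/ν ≤ 1`,
`w₁ ∈ F (U/κ)`, and the admissibility of `ε` at `(ν', U)` is its admissibility at `(ν, U/κ)`; dilate
the step from `w₁` by `κ`. Transfer at one Reynolds number is transfer at every larger one, for such
designs. [cite: Tao2011, footnote 3] -/
theorem Transfers.of_le (hH : 𝒮.AmplitudeHomogeneous) {ν ν' : ℝ} (h : 𝒮.Transfers ν) (hν' : 0 < ν')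
    (hle : ν' ≤ ν) : 𝒮.Transfers ν' := by
  have hν : 0 < ν := hν'.trans_le hle
  set κ : ℝ := ν' / ν with hκdef
  have hκ : 0 < κ := div_pos hν' hν
  have hκ1 : κ ≤ 1 := (div_le_one hν).2 hle
  have hκν : κ * ν = ν' := div_mul_cancel₀ ν' hν.ne'
  intro U hU w hw ε hε hε1 hadm
  -- read `w` as `κ • w₁` with `w₁ ∈ F (U/κ)`
  have hw' : w ∈ (𝒮.dilate κ hκ).F U := by rwa [hH.dilate_F_eq hκ]
  have hT' : (𝒮.dilate κ hκ).Transfers ν' := by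
    have := h.dilate hκ
    rwa [hκν] at this
  have hU' : (𝒮.dilate κ hκ).UStar ≤ U := by
    rw [dilate_UStar]
    calc κ * 𝒮.UStar ≤ 1 * 𝒮.UStar := mul_le_mul_of_nonneg_right hκ1 𝒮.UStar_pos.le
      _ = 𝒮.UStar := one_mul _
      _ ≤ U := hU
  exact (hT' U hU' w hw' ε hε hε1 hadm).of_dilate_of_le_one hH hκ hκ1 hε.le

/-- **Where a sweep's NO-GO word bites hardest (homogeneous alphabets).** A missing step at one
admissible `(U, w, ε)` at viscosity `ν'` refutes `𝒮.Transfers ν` for EVERY `ν ≥ ν'`: for such designs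
the word at the LOWEST viscosity of a sweep is the strongest the sweep can print against the scheme.
[folklore] -/
theorem not_transfers_of_not_step_of_le (hH : 𝒮.AmplitudeHomogeneous) {ν ν' U ε : ℝ} {w : Vel}
    (hν' : 0 < ν') (hle : ν' ≤ ν) (hU : 𝒮.UStar ≤ U) (hw : w ∈ 𝒮.F U) (hε : 0 < ε) (hε1 : ε ≤ 1)
    (hadm : ν' * |Real.log ε| ≤ 𝒮.a * U) (hno : ¬ 𝒮.Step ν' U ε w) : ¬ 𝒮.Transfers ν :=
  fun h => not_transfers_of_not_step hU hw hε hε1 hadm hno (h.of_le hH hν' hle)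

end TriggerScheme

end Summit.NavierStokesRegularity.FluidComputer.TriggeredTransfer

end
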